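import Summits.QuantumFields.YangMills.Theorems.UnitScaleTiltProp7SectET3Geometry
import Summits.QuantumFields.YangMills.Theorems.UnitScaleTiltProp7SectET3Members
import Literature.MathematicalPhysics.QuantumFieldTheory.Balaban1983to89.B9
import Literature.MathematicalPhysics.QuantumFieldTheory.Balaban1983to89.B9RWSumsReadsNbr
import HarnessLib

/-!
# Route `UnitScaleTilt`, crux «MinimiserStabilityRegPr» (stmt-QuantumFields-19200, v10 stub EX, route (α), node N06(d = 3)) — the M-FLOOR JUNCTION for the record-species leaves:
# **`B9.Thm313Printed` ∕ `B9.Thm312Printed` OVER THE MEMBERS ABOVE A FLOOR `M⋆` IMPLY THEM OVER THE WHOLE INDEX** (the printed ∃-threshold absorbs the floor), and the two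
# floor-dependent geometry rows of Track A's leaves of record (`hnbr`, `hCL`) DISCHARGED at `geo9K` above a floor

Cell `ym3-torus` (HUMAN RULING D-0037, YM ladder rung R3 — NOT the Clay problem), width seat ym-ust-20520-w1 g3.  Count-neutral helper (`--supports stmt-QuantumFields-19200 --as
helper`); registry untouched; THEOREMS ONLY (0 `def`, 0 `sorry`); nothing of [Balaban1985BackgroundPropagators] asserted.

WHY (located in this seat's HANDOFF block, item (iii)).  OWNER RULING g25-№2 fixes the N06(d = 3) text of record as Track A's leaves `thm313Printed_completePairMBZ` ∕
`thm312Printed_completePairMBZ` (residual ABSORBED) read at d + 1 = 3.  Those leaves carry two geometry binders WITHOUT an M-threshold — `hnbr : ∀ i y, #(nbr (geo i) r y) ≤ mN` and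
`hCL : ∀ i a a', dist a a' ≤ r → len a ≤ C_L·len a'` — which Track A discharges at def-Y's members `MemberY … M⋆` because that index has a FLOOR `M⋆ ≤ M` built in
(`B9GeoNbrCountKLevelV1` §3, `B9RWSumsCompleteGeo9YNbr`).  The T³ index `KIdx 2 ℓ hd3 hL b₀ b₁` (★w3-20520 g2) has NO floor, and both rows are false uniformly in `M` (the count grows,
the level comparison needs `r < M`).  THIS FILE supplies the junction so a successor can port the leaves of record VERBATIM over the floor subtype `{i // M⋆ ≤ (geo9K i).M}`:
§1 (generic, any index ∕ geometry ∕ backgrounds) ★ `thm313Printed_of_floor`, ★ `thm312Printed_of_floor` — the printed statements over the subtype above `M⋆` imply them over the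
whole index, the threshold becoming `max M₄ M⋆` (print: «for M sufficiently large»); §2 (at `geo9K`, d + 1 = 3) `hnbr_geo9K_floor` (★w3's ∕ n06-i's `exists_card_nbr_geo9K_le`
repackaged over the floor subtype) and `hCL_geo9K_floor` (`len_le_of_dist_lt_M_geo9K` under `r < M⋆ ≤ M`, `C_L = ℓ + 1`).
HONEST SCOPE: bookkeeping; no estimate; N06(d = 3) NOT discharged; nothing here claims EX, the crux, V3∕R3, d = 4 or the mass gap; rung R3, not Clay.

References: T. Bałaban, CMP **99** (1985) 389–434 [Balaban1985BackgroundPropagators] (Thm 3.12 p.423, Thm 3.13 p.426 («for α₀ sufficiently small», M-threshold), (3.41) p.397);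
CMP **96** (1984) 223–250 [Balaban1984PropagatorsII] ((2.2) p.224, (2.46) p.231, Lemma 2.1 (2.59)–(2.61) pp.233–234).
-/

set_option autoImplicit false

noncomputable section

namespace Summit.QuantumFields.YangMills.Theorems.Prop7SectET3Floor

open Literature.MathematicalPhysics.QuantumFieldTheory.Balaban1983to89
open Literature.MathematicalPhysics.QuantumFieldTheory.Balaban1983to89.B6KLevelCensusIndexV1 (KIdx)
open Literature.MathematicalPhysics.QuantumFieldTheory.Balaban1983to89.B9GeoNormsKLevelV1 (geo9K)
open Literature.MathematicalPhysics.QuantumFieldTheory.Balaban1983to89.B9RWSumsReadsNbr (nbr)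
open Literature.MathematicalPhysics.QuantumFieldTheory.Balaban1983to89.B9GeoNbrCountKLevelV1 (exists_card_nbr_geo9K_le)
open Literature.MathematicalPhysics.QuantumFieldTheory.Balaban1983to89.B9RWSumsCompleteGeo9YNbr (len_le_of_dist_lt_M_geo9K)
open Summit.QuantumFields.YangMills.Theorems.Prop7SectET3Members (hd3)

/-! ## §1 Generic: the printed Theorems 3.13 ∕ 3.12 over the members above a floor imply them over the whole index -/

section Generic

variable {I : Type} {c35 : ℝ} {geo : I → B9.Geometry} {bg : I → B9.Backgrounds}

/-- ★ **THEOREM 3.13's PRINTED STATEMENT OVER THE FLOOR SUBTYPE IMPLIES IT OVER THE WHOLE INDEX**: if `B9.Thm313Printed` holds for the family restricted to `{i // M⋆ ≤ (geo i).M}`,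
it holds for the full family — its own `∃ M₄` threshold becomes `max M₄ M⋆` («for M sufficiently large»); members below the floor are never asked. [cite: Balaban1985BackgroundPropagators, Thm 3.13 p.426] -/
theorem thm313Printed_of_floor (Mstar : ℝ) {GG : ∀ i, B9.KernelFamily (geo i) (bg i)}
    {HasRWExp : ∀ i, B9.KernelFamily (geo i) (bg i) → (bg i).Cfg → ℝ → Prop} {PosDefK : ∀ i, B9.KernelFamily (geo i) (bg i) → (bg i).Cfg → Prop}
    (h : B9.Thm313Printed c35 (fun j : {i : I // Mstar ≤ (geo i).M} => geo j.1) (fun j => bg j.1) (fun j => GG j.1) (fun j => HasRWExp j.1)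
      (fun j => PosDefK j.1)) :
    B9.Thm313Printed c35 geo bg GG HasRWExp PosDefK := by
  obtain ⟨M₄, δ₀, a₀, B₀, Bβ, Bε, Bεβ, hM₄, hδ₀, ha₀, hB₀, H⟩ := h
  refine ⟨max M₄ Mstar, δ₀, a₀, B₀, Bβ, Bε, Bεβ, lt_max_of_lt_left hM₄, hδ₀, ha₀, hB₀, fun i hM α₀ hα₀ hMa U hU hU' => ?_⟩
  exact H ⟨i, (le_max_right _ _).trans hM⟩ ((le_max_left _ _).trans hM) α₀ hα₀ hMa U hU hU'

/-- ★ **THEOREM 3.12's PRINTED STATEMENT OVER THE FLOOR SUBTYPE IMPLIES IT OVER THE WHOLE INDEX** (same bookkeeping). [cite: Balaban1985BackgroundPropagators, Thm 3.12 p.423] -/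
theorem thm312Printed_of_floor (Mstar : ℝ) (d : ℕ) {GD G₁ : ∀ i, B9.KernelFamily (geo i) (bg i)} {Hk H₁k : ∀ i, B9.HKernel (geo i) (bg i)}
    {HasRWExp : ∀ i, B9.KernelFamily (geo i) (bg i) → (bg i).Cfg → ℝ → Prop}
    {HasRWExpH : ∀ i, B9.HKernel (geo i) (bg i) → (bg i).Cfg → ℝ → Prop} {PosDefK : ∀ i, B9.KernelFamily (geo i) (bg i) → (bg i).Cfg → Prop}
    (h : B9.Thm312Printed d c35 (fun j : {i : I // Mstar ≤ (geo i).M} => geo j.1) (fun j => bg j.1) (fun j => GD j.1) (fun j => G₁ j.1) (fun j => Hk j.1)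
      (fun j => H₁k j.1) (fun j => HasRWExp j.1) (fun j => HasRWExpH j.1) (fun j => PosDefK j.1)) :
    B9.Thm312Printed d c35 geo bg GD G₁ Hk H₁k HasRWExp HasRWExpH PosDefK := by
  obtain ⟨M₄, δ₀, a₀, B₀, Bβ, Bε, Bεβ, hM₄, hδ₀, ha₀, hB₀, H⟩ := h
  refine ⟨max M₄ Mstar, δ₀, a₀, B₀, Bβ, Bε, Bεβ, lt_max_of_lt_left hM₄, hδ₀, ha₀, hB₀, fun i hM α₀ hα₀ hMa U hU hU' => ?_⟩
  exact H ⟨i, (le_max_right _ _).trans hM⟩ ((le_max_left _ _).trans hM) α₀ hα₀ hMa U hU hU'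

end Generic

/-! ## §2 At the T³ reading `geo9K` (d + 1 = 3): the two floor-dependent geometry rows of the leaves of record above a floor -/

section T3

variable {ℓ : ℕ} {hL : Odd (ℓ + 1) ∧ 1 < ℓ + 1} {b₀ b₁ : ℝ}

/-- **`hnbr` ABOVE A FLOOR**: for every radius `r` there are a floor `M⋆` and a count `mN` such that every member of the floor subtype `{i // M⋆ ≤ (geo9K i).M}` has `#(nbr (geo9K i) r y) ≤ mN`
at every index bond `y` — n06-i's `exists_card_nbr_geo9K_le` ((2.61) at rate 1), in the binder shape of `thm313Printed_completePairMBZ` over the subtype.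
[cite: Balaban1984PropagatorsII, Lemma 2.1 (2.61) p.234, (2.59) p.233, (2.46) p.231] -/
theorem hnbr_geo9K_floor [∀ i : KIdx 2 ℓ hd3 hL b₀ b₁, Fintype (geo9K i).Site] (r : ℝ) :
    ∃ Mstar : ℝ, ∃ mN : ℕ, ∀ (j : {i : KIdx 2 ℓ hd3 hL b₀ b₁ // Mstar ≤ (geo9K i).M}) (y : (geo9K j.1).Site), (nbr (geo9K j.1) r y).card ≤ mN := by
  obtain ⟨ML, mN, h⟩ := exists_card_nbr_geo9K_le (d := 2) (ℓ := ℓ) (hd := hd3) (hL := hL) (b₀ := b₀) (b₁ := b₁) r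
  exact ⟨ML, mN, fun j y => h j.1 j.2 y⟩

/-- **`hCL` ABOVE A FLOOR**: on every member with `r < M` (in particular on the floor subtype `{i // M⋆ ≤ M}` for any `M⋆ > r`), two index bonds at distance `≤ r` have scale lengths within
the factor `C_L = ℓ + 1` — `len_le_of_dist_lt_M_geo9K` (neighbouring blocks differ by at most one level). [cite: Balaban1984PropagatorsII, (2.2) p.224, Lemma 2.1 (2.60) p.234] -/
theorem hCL_geo9K_floor {r Mstar : ℝ} (hr : r < Mstar) (j : {i : KIdx 2 ℓ hd3 hL b₀ b₁ // Mstar ≤ (geo9K i).M}) (a a' : (geo9K j.1).Site)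
    (h : (geo9K j.1).dist a a' ≤ r) : (geo9K j.1).len a ≤ ((ℓ + 1 : ℕ) : ℝ) * (geo9K j.1).len a' :=
  len_le_of_dist_lt_M_geo9K j.1 (lt_of_le_of_lt h (hr.trans_le j.2))

/-- The floor subtype is the right index for the port: its members' geometry, backgrounds and every T³ row are those of the underlying member (`j.1`), so a leaf of record proved over
`{i // M⋆ ≤ (geo9K i).M}` lifts to `KIdx 2 ℓ hd3 hL b₀ b₁` by `thm313Printed_of_floor M⋆` — recorded as the one-line recipe. [cite: Balaban1985BackgroundPropagators, Thm 3.13 p.426 (bookkeeping)] -/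
theorem thm313Printed_geo9K_of_floor {c35 : ℝ} (Mstar : ℝ) {bg : KIdx 2 ℓ hd3 hL b₀ b₁ → B9.Backgrounds}
    {GG : ∀ i : KIdx 2 ℓ hd3 hL b₀ b₁, B9.KernelFamily (geo9K i) (bg i)}
    {HasRWExp : ∀ i : KIdx 2 ℓ hd3 hL b₀ b₁, B9.KernelFamily (geo9K i) (bg i) → (bg i).Cfg → ℝ → Prop}
    {PosDefK : ∀ i : KIdx 2 ℓ hd3 hL b₀ b₁, B9.KernelFamily (geo9K i) (bg i) → (bg i).Cfg → Prop}
    (h : B9.Thm313Printed c35 (fun j : {i : KIdx 2 ℓ hd3 hL b₀ b₁ // Mstar ≤ (geo9K i).M} => geo9K j.1) (fun j => bg j.1) (fun j => GG j.1)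
      (fun j => HasRWExp j.1) (fun j => PosDefK j.1)) :
    B9.Thm313Printed c35 geo9K bg GG HasRWExp PosDefK :=
  thm313Printed_of_floor (geo := geo9K) Mstar h

end T3

end Summit.QuantumFields.YangMills.Theorems.Prop7SectET3Floor

end
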